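import Literature.AlgebraicGeometry.HodgeTheory.SemiregularVariationalHodgeFull
import HarnessLib

/-!
# Buchweitz–Flenner 2003, Thm. 5.1 for a GENERAL index set `I` (named fact; the tree's `I = {1, 2}` rendering
# is its special case)

Family `hodge`, layer `Literature/AlgebraicGeometry/HodgeTheory`. NAMED FACT (D-0014) requested by the ladder note
`papers/HodgeConjecture/hodge-weil-ladder` (packet `run/shared/lean/b2b/hodge-weil/`, GAPS G44, LADDER `## CARVER v8`
C62 "door II′": Buchweitz–Flenner seeds with `I = {1, 2, 3}` or `{1, 2, 3, 4}`, i.e. sheaves whose `ch₃` (the Weil class)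
is to stay algebraic). `SemiregularVariationalHodge.lean` renders [BuchweitzFlenner2003, Thm. 5.1] only for `I = {1, 2}`
(`BuchweitzFlenner2003_variationalHodge_semiregular`), because when it was filed only `σ_0`, `σ_1` had carriers; since
`SemiregularityHigherSigma.lean` the tree constructs every component `σ_q : Ext²(E, E) → H^{q+2}(X, Ω^q)` (`sigmaHigher`)
and BF's notion `IsISemiregular hE I` for a finite locally free `E` and any set `I` of FORM degrees. This file states the
theorem for an arbitrary finite set `I` of CHERN degrees, on exactly the carriers of the `I = {1, 2}` rendering, and PROVES
that the old rendering follows from it.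

## Source, verbatim (held text `paper:arxiv-math_9912245` = Compositio Math. 137 (2003), §5, p. 25 of the arXiv text)

"Slightly more generally, with `n` the dimension of `X_0` it is convenient to introduce for any subset `I ⊆ {0, …, n}` the
following notion: `ℰ_0` is called `I`-semiregular if the part of the semiregularity map
`σ_I : Ext²_{X_0}(ℰ_0, ℰ_0) → ∏_{p ∈ I} H^{p+1}(X_0, Ω^{p−1}_{X_0})` is injective. […] **Theorem 5.1.** Let `π : X → S` be
a deformation of a compact complex algebraic manifold `X_0` over a smooth germ `S = (S, 0)` and set `X_s := π⁻¹(s)` for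
`s ∈ S`. Assume that `(α_p)_{p ∈ I}` is a horizontal section in `∏_{p∈I} R^pπ_*(Ω^p_{X/S})`. If there is an
`I`-semiregular sheaf `ℰ_0` on `X_0` with `α_p(0) = ch_p(ℰ_0) ∈ H^p(X_0, Ω^p_{X_0})`, `p ∈ I`, then
`α_p(s) ∈ H^p(X_s, Ω^p_{X_s})` is algebraic for all `s ∈ S` near `0` and each `p ∈ I`." ("horizontal": "can be lifted
locally to a horizontal section in `R^{2p}f_*(Ω^{≥p}_{X/S}) ⊆ R^{2p}f_*(ℂ) ⊗ 𝒪_S`", ibid.)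

## Rendering (as in `SemiregularVariationalHodge.lean`, module docstring there; only `I` is new)

* Deformation, horizontality, "algebraic", "near `0`": verbatim the carriers of the `I = {1,2}` fact — an algebraic smooth
  projective family `π : 𝒳 ⟶ S` of relative dimension `n` over a smooth `ℂ`-scheme, a cohomologically locally trivial
  `U ⊆ S(ℂ)` with base point `s₀`, flat transports `transportFun` of `ch_p(ℰ_0)` (Chern character theory
  `C : ChernCharacterBetti`) of Hodge type `(p, p)` on the fibres reached (= a horizontal section of `R^{2p}π_*ℂ` in `F^p`),
  conclusion on an open `W ∋ s₀` for paths inside `W`, `algebraicClasses (X_t) p`.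
* `I`: a FINITE set of Chern degrees `p` (`Finset ℕ`; the source has `I ⊆ {0, …, n}`; degrees `p > n` carry the zero class
  and `p = 0` the rank, both harmless). BF's `σ_I = (Ext² → H^{p+1}(Ω^{p−1}))_{p ∈ I}` is, in the tree's numbering by FORM
  degree `q = p − 1`, the family `(sigmaHigher hE q)_{q + 1 ∈ I}`; so "`ℰ_0` is `I`-semiregular" is
  `IsISemiregular hE₀ {q | q + 1 ∈ I}` (`p = 0 ∈ I` contributes no component, as `Ω^{−1} = 0` in the source). BF's
  components carry the scalars `(−1)^q/q!`, immaterial for kernels over `ℂ` (normalisation note of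
  `SemiregularityHigherSigma`).
* `ℰ_0` finite locally free (`Motives.IsFiniteLocallyFree`; the source allows coherent `ℰ_0` — NOT rendered: the tree's
  Atiyah class / `σ_q` need a locally free `E`; the coherent and perfect-complex versions [BuchweitzFlenner2003, Thm. 5.1
  for modules], [Pridham2024] would need `At` of a complex — recorded as the residual gap of G44).

## Consumers

`WeilClassesBFSheafSeed.lean` (door II′ of the Weil ladder, packet `run/shared/lean/b2b/hodge-weil/`: the bridge
`BuchweitzFlenner2003_variationalHodge_ISemiregular ∧ HasTensorBFSheafSeeds ⟹ HasLocallyAlgebraicTensorAnchors`).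

## What is PROVED here

`isISemiregular_shift_of_isZeroOneSemiregular` (`{0,1}`-semiregular ⟹ `I`-semiregular for the form degrees of
`I = {1, 2}`), `BuchweitzFlenner2003_variationalHodge_semiregular_of_ISemiregular` (the general-`I` fact implies the tree's
`I = {1, 2}` fact), and the consumer shape `…_ISemiregular.ch_mem_algebraicClasses` (one degree `p ∈ I`). The content of
Thm. 5.1 (BF §3 obstruction theory, Prop. 5.9 / Lemma 5.10, versality, Artin approximation) is not formalised: the fact
stays a named fact, exactly like its `I = {1, 2}` sibling.

## References

* [BuchweitzFlenner2003] R.-O. Buchweitz, H. Flenner, A semiregularity map for modules and applications to deformations,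
  Compositio Math. 137 (2003), 135–210 (arXiv:math/9912245), §5 Thm. 5.1, §5 (`I`-semiregular), Def. 4.1.
* [Pridham2024] J. P. Pridham, Semiregularity as a consequence of Goodwillie's theorem, Forum Math. Sigma 12 (2024) (the
  perfect-complex generalisation; not rendered).
-/

noncomputable section

open CategoryTheory AlgebraicGeometry
open _root_.Topology _root_.Filter
open Literature.AlgebraicTopology.SingularHomology

namespace Literature.AlgebraicGeometry.HodgeTheory

universe w u

/-- **Buchweitz–Flenner 2003, Thm. 5.1 (the partial Chern character of an `I`-semiregular sheaf stays algebraic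
along a deformation — their affirmative answer to Grothendieck's variational Hodge question in this case), general
finite `I`.** Printed: "Assume that `(α_p)_{p ∈ I}` is a horizontal section in
`∏_{p∈I} R^pπ_*(Ω^p_{X/S})`. If there is an `I`-semiregular sheaf `ℰ_0` on `X_0` with `α_p(0) = ch_p(ℰ_0)`, `p ∈ I`,
then `α_p(s) ∈ H^p(X_s, Ω^p_{X_s})` is algebraic for all `s ∈ S` near `0` and each `p ∈ I`", where "`ℰ_0` is called
`I`-semiregular if the part `σ_I : Ext²(ℰ_0, ℰ_0) → ∏_{p ∈ I} H^{p+1}(X_0, Ω^{p−1})` of the semiregularity map is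
injective". Rendering (module docstring): for every Chern character theory `C`, smooth projective family `π : 𝒳 ⟶ S` of
relative dimension `n` over a smooth `ℂ`-scheme, cohomologically locally trivial `U ⊆ S(ℂ)` with base point `s₀`, finite
set `I` of Chern degrees, and finite locally free `ℰ_0` on `X_{s₀}` with `(σ_{p−1})_{p ∈ I}` jointly injective
(`IsISemiregular hE₀ {q | q + 1 ∈ I}`): if for every `p ∈ I` the transports of `ch_p(ℰ_0)` along all paths in `U` are
of type `(p, p)`, then on some open `W`, `s₀ ∈ W ⊆ U`, the transports of `ch_p(ℰ_0)` (`p ∈ I`) along paths inside `W`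
are ALGEBRAIC classes of the fibres. [cite: BuchweitzFlenner2003, §5 Thm. 5.1] -/
def BuchweitzFlenner2003_variationalHodge_ISemiregular : Prop :=
  ∀ (C : ChernCharacterBetti) ⦃𝒳 S : Motives.SchemeOver ℂ⦄ (π : 𝒳 ⟶ S) (n : ℕ),
    Motives.IsSmoothProjectiveFamily π n → _root_.AlgebraicGeometry.Smooth S.hom →
    ∀ ⦃U : Set (Motives.ComplexPoints S)⦄ (hU : IsCohomologicallyLocallyTrivialOn π U) (s₀ : U)
      (E₀ : (Motives.fiberOver π s₀.1).left.Modules) (hE₀ : Motives.IsFiniteLocallyFree E₀) (I : Finset ℕ),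
      IsISemiregular hE₀ {q | q + 1 ∈ I} →
      (∀ p ∈ I, ∀ (t : U) (γ : Path.Homotopic.Quotient s₀ t),
          IsOfHodgeType n (Motives.fiberOver π t.1) (2 * p) p p
              (transportFun π (2 * p) hU γ (C.ch (Motives.fiberOver π s₀.1) E₀ p))) →
      ∃ (W : Set (Motives.ComplexPoints S)) (hWo : IsOpen W) (hW₀ : s₀.1 ∈ W) (hWU : W ⊆ U),
        ∀ p ∈ I, ∀ (t : W) (γ : Path.Homotopic.Quotient (⟨s₀.1, hW₀⟩ : W) t),
          transportFun π (2 * p) (hU.mono hWU hWo) γ (C.ch (Motives.fiberOver π s₀.1) E₀ p) ∈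
              algebraicClasses (Motives.fiberOver π t.1) p

/-- **Consumer shape: one degree.** Under the fact, for each `p ∈ I` the transport of `ch_p(ℰ_0)` is algebraic on every
fibre over the neighbourhood `W` reached by a path in `W` (e.g. `p = 3 ∈ I = {1, 2, 3}`: the degree-6 class of a door-II′
seed of the ladder note). [cite: BuchweitzFlenner2003, §5 Thm. 5.1] -/
theorem BuchweitzFlenner2003_variationalHodge_ISemiregular.ch_mem_algebraicClasses
    (hBF : BuchweitzFlenner2003_variationalHodge_ISemiregular) (C : ChernCharacterBetti)
    {𝒳 S : Motives.SchemeOver ℂ} (π : 𝒳 ⟶ S) (n : ℕ) (hπ : Motives.IsSmoothProjectiveFamily π n)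
    (hS : _root_.AlgebraicGeometry.Smooth S.hom) {U : Set (Motives.ComplexPoints S)}
    (hU : IsCohomologicallyLocallyTrivialOn π U) (s₀ : U) (E₀ : (Motives.fiberOver π s₀.1).left.Modules)
    (hE₀ : Motives.IsFiniteLocallyFree E₀) (I : Finset ℕ) (hsr : IsISemiregular hE₀ {q | q + 1 ∈ I})
    (hHodge : ∀ p ∈ I, ∀ (t : U) (γ : Path.Homotopic.Quotient s₀ t),
      IsOfHodgeType n (Motives.fiberOver π t.1) (2 * p) p p
        (transportFun π (2 * p) hU γ (C.ch (Motives.fiberOver π s₀.1) E₀ p)))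
    {p : ℕ} (hp : p ∈ I) :
    ∃ (W : Set (Motives.ComplexPoints S)) (hWo : IsOpen W) (hW₀ : s₀.1 ∈ W) (hWU : W ⊆ U),
      ∀ (t : W) (γ : Path.Homotopic.Quotient (⟨s₀.1, hW₀⟩ : W) t),
        transportFun π (2 * p) (hU.mono hWU hWo) γ (C.ch (Motives.fiberOver π s₀.1) E₀ p) ∈
          algebraicClasses (Motives.fiberOver π t.1) p := by
  obtain ⟨W, hWo, hW₀, hWU, hW⟩ := hBF C π n hπ hS hU s₀ E₀ hE₀ I hsr hHodge
  exact ⟨W, hWo, hW₀, hWU, fun t γ => hW p hp t γ⟩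

/-- **`{0,1}`-semiregular ⟹ `I`-semiregular for the form degrees `{q | q + 1 ∈ {1, 2}} = {0, 1}`**: the components
`σ_0`, `σ_1` of `SemiregularityHigherSigma` are `sigmaZero`, `sigmaOne` of `AtiyahClassTraceReal` under the additive
equivalences `hodgeCohomologyZeroAddEquiv`, `hodgeCohomologyOneAddEquiv` (proved there).
[cite: BuchweitzFlenner2003, §5 (I-semiregular)] -/
theorem isISemiregular_shift_of_isZeroOneSemiregular {S : Type u} [CommRing S]
    {X : Over (Spec (CommRingCat.of S))} [HasExt.{w} X.left.Modules] {E : X.left.Modules}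
    (hE : Motives.IsFiniteLocallyFree E) (h : IsZeroOneSemiregular.{w} hE) :
    IsISemiregular.{w} hE {q | q + 1 ∈ ({1, 2} : Finset ℕ)} := by
  intro x hx
  refine (isZeroOneSemiregular_iff hE).1 h x ?_ ?_
  · rw [← hodgeCohomologyZeroAddEquiv_sigmaHigher_zero hE x, hx 0 (by simp), map_zero]
  · rw [← hodgeCohomologyOneAddEquiv_sigmaHigher_one hE x, hx 1 (by simp), map_zero]

/-- **The `I = {1, 2}` rendering follows from the general one**: `BuchweitzFlenner2003_variationalHodge_ISemiregular`
implies the tree's `BuchweitzFlenner2003_variationalHodge_semiregular` (same carriers; `{0,1}`-semiregularity gives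
`I`-semiregularity for `I = {1, 2}` by `isISemiregular_shift_of_isZeroOneSemiregular`). [cite: BuchweitzFlenner2003, §5 Thm. 5.1] -/
theorem BuchweitzFlenner2003_variationalHodge_semiregular_of_ISemiregular
    (hBF : BuchweitzFlenner2003_variationalHodge_ISemiregular) :
    BuchweitzFlenner2003_variationalHodge_semiregular := by
  intro C 𝒳 S π n hπ hS U hU s₀ E₀ hE₀ hsr hHodge
  have hH : ∀ p ∈ ({1, 2} : Finset ℕ), ∀ (t : U) (γ : Path.Homotopic.Quotient s₀ t),
      IsOfHodgeType n (Motives.fiberOver π t.1) (2 * p) p p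
        (transportFun π (2 * p) hU γ (C.ch (Motives.fiberOver π s₀.1) E₀ p)) := by
    intro p hp t γ
    simp only [Finset.mem_insert, Finset.mem_singleton] at hp
    rcases hp with rfl | rfl
    · exact (hHodge t γ).1
    · exact (hHodge t γ).2
  obtain ⟨W, hWo, hW₀, hWU, hW⟩ :=
    hBF C π n hπ hS hU s₀ E₀ hE₀ {1, 2} (isISemiregular_shift_of_isZeroOneSemiregular hE₀ hsr) hH
  exact ⟨W, hWo, hW₀, hWU, fun t γ => ⟨hW 1 (by simp) t γ, hW 2 (by simp) t γ⟩⟩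

end Literature.AlgebraicGeometry.HodgeTheory

end
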